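import Literature.MathematicalPhysics.QuantumFieldTheory.Balaban1983to89.Node00.DatumAvLayer
import Literature.MathematicalPhysics.QuantumFieldTheory.Balaban1983to89.B14Eq216Concrete
import Literature.MathematicalPhysics.QuantumFieldTheory.Balaban1983to89.B16B10Shape
import Literature.MathematicalPhysics.QuantumFieldTheory.Balaban1983to89.B14

/-!
# NODE 00 — DEFINER ₇, FILE 1: the small-field function `χ_k(T_η)` ([III] (2.17)), the small-field domains ([I] p. 259)
# and the initial constant `E` ([III] (1.15), p. 254, Thm 1 p. 262) AS TOTAL DEFINITIONS OF RECORD, together with the ONE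
# new object they need: the solution map of the variational problem (2.12) [III] as a total function (chair R434 (c2) idiom)

Seat `pub-ymgap-node00-def-R` (DEFINER ₇; reports to node00-def).  [III] = [Balaban1988Convergent], [I] = [Balaban1987RG1],
[IV] = [Balaban1989LargeFieldI], [B16] = [Balaban1989LargeFieldII], [15] = [Balaban1985PropagatorsII] ([B11]).

WHAT THIS FILE IS.  `Node00.Record5`'s residual `Residual₅` keeps `χ`, `dom`, `E` (and `R`, FILE 2) as free structure fields.
This file supplies TOTAL definitions for them, typed BY NAME against the tree: `χ` of record is r11's (2.17) function
`B14.Eq216Concrete.chi217` over ALL cubes of the `LM₂R_k`-partition of `T_η` (the `χ_k(T_η)` consumed by [B16] (0.1),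
`B16.RunData.χ`), whose background is the LOCAL minimiser (2.16) `U_{k,□}(V_k) = U(𝐁_k(□^{∼4}), M˙(Q_k^{s*}V_k))`
(`B14.Eq216Concrete.ukBox`) — NOT the global `U_k(V)` of (0.21) [I] ∕ (2.18) [III] (that ONE is node00-def-B's `Uk`, in
`Node00/BackgroundActionOfRecord.lean`); the local minimisers are values of the determining-set solution map `U(𝔹, ·)` of (2.12),
which §2 defines ONCE, totally: v1 (p411542) by the chair's (c2) idiom (INBOX l.9351) `if h : ∃ minimiser then Classical.choose h else 1`;
v2 (THIS REVISION, route (B) of director-ym LINE №128 ∕ dag-lead WORDS-119, K′-side PROBE v3 PASS l.15316) with a MEASURABLE-SELECTION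
first branch — `if h : ∃ F, SelSpec F then (Classical.choose h) (IsMinimizer … W) else <v1 body>`, where an admissible selector `F` is FED THE
(2.12) PREDICATE (so the map is a function of the predicate BY CONSTRUCTION: `UminOfRecord_congr_of_isMinimizer_iff₀`; every v1 face —
`isMinimizer_UminOfRecord`, `UminOfRecord_of_not` — keeps its statement) and `W ↦ F(IsMinimizer … W)` is measurable, minimising on the solvable
set and `1` off it (`SelSpec`); when such an `F` exists the map IS MEASURABLE (`measurable_UminOfRecord_of_exists_selSpec`, and from a `W`-fed
measurable ∕ minimising ∕ unit-off ∕ DETERMINED selector: `measurable_UminOfRecord_of_selector` — the shape the K′-side supplies at `SU(N)`,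
`Record12MinimiserSelection.exists_measurable_isMinimizer_selector_determined`).  The one signature change: `UminOfRecord` ∕ `bgOfRecord` and their
faces now read an instance `[MeasurableSpace G]` (synthesized at `SU(N)`; `solvableDom` does not).  The minimising property stays a THEOREM on the
solvable set; [15] Thm 1 (existence ∕ uniqueness mod gauge on regular data) NOT asserted; measurability of the map at the record is NOT asserted
here (it is the K′-side's theorem from the selector).
`dom` of record: [I] p. 259 prints two definitions — the SECOND (residual-free) is typed here (§5); the FIRST (over the global background
`U_k(V)`, node00-def-B's `Uk`) lands in `Node00/SmallFieldDomOfRecord.lean`; node00-def plugs one.  `E` of record (§6): the sum over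
all scales of the one-step vacuum-energy expressions ([III] p. 262 l. 17–21, p. 254 l. 14–16, (1.15) p. 249), typed so that the
tree's pv24 hypotheses `B16B10Shape.CountertermData.OneStep115 ∕ ESum ∕ TstarCount` hold BY `rfl` for the record's carrier; the
one-step fluctuation constants `E^{(j+1)}(T^{(j+1)}, g_j, 1)` and `log z_j` are INPUTS (they belong to the small-field step, ₈).

WHAT THIS FILE IS NOT.  Nothing of Bałaban's is asserted: no existence of minimisers, no bound, no positivity; every displayed
ESTIMATE of print stays a display (docstring locator).  The numerics `Stage7Numerics` are parameters for node00-def's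
`Stage7Params`.  No `instance`, no `notation`, no `sorry`, no axiom beyond the standard three.  HONEST FRAMING: definitions of
record and `rfl`-level bookkeeping; counts unmoved; NOT continuum ∕ OS ∕ mass-gap ∕ Clay.
-/

noncomputable section

open MeasureTheory
open scoped BigOperators

namespace Literature.MathematicalPhysics.QuantumFieldTheory.Balaban1983to89.Node00

open T4Continuum B15DeterminingSets B14.Eq213DetSet B14.Eq216Concrete B14.Eq213MaximalDomains B15Eq112TorusCover
  B14DomainGeom B16B10Shape

/-! ## §1  The numerics of stage ₇ -/

/-- The numeric parameters the ₇ definitions read (for node00-def's `Stage7Params`): `M₁` = the layer width of the (2.13)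
determining sets ([III] p. 256); `M₂` = the cube-size factor of the `LM₂R_k`-partition of (2.17) (p. 257); `r` = the exponent
of (2.5) (`R_j ≥ (log g_j⁻²)^r`, p. 255); `p₀`, `A₀` = the small-field profile `ε_k = g_k A₀ (log g_k⁻²)^{p₀}` ((2.4) p. 255,
`Setup.p0Profile`); `logσ₀ = log σ₀` ((2.8) [I], the constant in (1.15) [III]); `εreg` = the threshold of the regularity class
of (2.12) ([15] Thm 1; the class at step `k` is `{U | |U(∂p) − 1| < εreg·η_k²}`, node00-def-B's `bgReg`); `ε₀` = the small-field-domain threshold of [I] p. 259. [cite: Balaban1988Convergent, (2.4)–(2.5) p.255, (2.13) p.256, (2.17) p.257] -/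
structure Stage7Numerics where
  /-- the layer width `M₁` of the (2.13) determining sets -/
  M₁ : ℕ
  /-- the cube-size factor `M₂` of the `LM₂R_k`-partition of (2.17) -/
  M₂ : ℕ
  /-- the exponent `r` of (2.5), `R_j ≥ (log g_j⁻²)^r` -/
  r : ℕ
  /-- the exponent `p₀` of the small-field profile (2.4) -/
  p₀ : ℕ
  /-- the constant `A₀` of the small-field profile (2.4) -/
  A₀ : ℝ
  /-- `log σ₀` ((2.8) [I]; the constant of (1.15) [III]) -/
  logσ₀ : ℝ
  /-- the regularity threshold of the (2.12) class (`{U | |U(∂p) − 1| < εreg·η_k²}` at step `k`) -/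
  εreg : ℝ
  /-- the small-field-domain threshold `ε₀` of [I] p. 259 -/
  ε₀ : ℝ

/-! ## §2  The solution map of (2.12) [III] as a TOTAL function (chair R434 (c2) idiom; v2: measurable-selection first branch) -/

section SolutionMap

variable {P : Params} {G : Type*} [GaugeGroup G] (av : ∀ j, Averaging P j G) (reg : Set (GaugeField P 0 G))

/-- The solvable set of the variational problem (2.12) for the determining set `𝔹`: the data `W` admitting a minimiser in the
class `reg`.  ([15] Thm 1 says it contains the regular data; not asserted.) [cite: Balaban1988Convergent, (2.12) p.256] -/
def solvableDom (𝔹 : DetSet P) : Set (MSField P G) :=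
  {W | ∃ U₀, IsMinimizer av reg 𝔹 W U₀}

/-- Membership in the solvable set. [cite: Balaban1988Convergent, (2.12) p.256 (bookkeeping)] -/
theorem mem_solvableDom_iff (𝔹 : DetSet P) (W : MSField P G) :
    W ∈ solvableDom av reg 𝔹 ↔ ∃ U₀, IsMinimizer av reg 𝔹 W U₀ := Iff.rfl

variable [MeasurableSpace G]

/-- **ADMISSIBLE SELECTORS FED BY THE (2.12) PREDICATE** (v2, route (B) of director-ym LINE №128): a map `F` from predicates on
configurations to configurations such that `W ↦ F(IsMinimizer … W)` is MEASURABLE, picks a minimiser whenever one exists, and returns the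
unit configuration otherwise.  Feeding `F` the predicate (not `W`) makes the solution map a function of the (2.12) predicate BY CONSTRUCTION
(the face `UminOfRecord_congr_of_isMinimizer_iff` ∕ `UbgOfRecord_zero_const` read downstream). [cite: Balaban1988Convergent, (2.12) p.256 (typing convention)] -/
def SelSpec (𝔹 : DetSet P) (F : (GaugeField P 0 G → Prop) → GaugeField P 0 G) : Prop :=
  Measurable (fun W : MSField P G => F (IsMinimizer av reg 𝔹 W)) ∧
    (∀ W : MSField P G, (∃ U₀, IsMinimizer av reg 𝔹 W U₀) → IsMinimizer av reg 𝔹 W (F (IsMinimizer av reg 𝔹 W))) ∧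
    (∀ W : MSField P G, ¬ (∃ U₀, IsMinimizer av reg 𝔹 W U₀) → F (IsMinimizer av reg 𝔹 W) = fun _ => 1)

open Classical in
/-- **The (2.12) solution map of record** `U(𝔹, W)`: [III] p. 256, verbatim: *"we consider the variational problem … for
U regular … with the conditions M(U) = V on the determining set"* ([15] Thm 1) — TOTALISED: a minimiser of the Wilson action in the
regularity class `reg` under the averaging constraints on `𝔹` (`B15DeterminingSets.IsMinimizer`) CHOSEN when one exists, and the
unit configuration otherwise (junk branch; typing convention) — v2: through an admissible PREDICATE-FED MEASURABLE SELECTOR (`SelSpec`)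
when one exists (first branch; the data `W` enters ONLY through the predicate `IsMinimizer … W`), else by bare choice (v1 body).  Existence ∕
uniqueness-mod-gauge ([15] Thm 1) is NOT asserted; consumers use `isMinimizer_UminOfRecord` ∕ `UminOfRecord_of_not` ∕
`UminOfRecord_congr_of_isMinimizer_iff₀` ∕ `measurable_UminOfRecord_of_selector`. [cite: Balaban1988Convergent, (2.12) p.256] -/
def UminOfRecord (𝔹 : DetSet P) (W : MSField P G) : GaugeField P 0 G :=
  if h : ∃ F, SelSpec av reg 𝔹 F then Classical.choose h (IsMinimizer av reg 𝔹 W)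
  else if h : ∃ U₀, IsMinimizer av reg 𝔹 W U₀ then Classical.choose h else fun _ => 1

/-- On the solvable set the chosen configuration IS a minimiser of (2.12) (by `Classical.choose_spec`; nothing of print asserted).
[cite: Balaban1988Convergent, (2.12) p.256] -/
theorem isMinimizer_UminOfRecord {𝔹 : DetSet P} {W : MSField P G} (h : ∃ U₀, IsMinimizer av reg 𝔹 W U₀) :
    IsMinimizer av reg 𝔹 W (UminOfRecord av reg 𝔹 W) := by
  unfold UminOfRecord
  split_ifs with hsel
  · exact (Classical.choose_spec hsel).2.1 W h
  · exact Classical.choose_spec h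

/-- Off the solvable set the solution map of record is the unit configuration (the documented junk default).
[cite: Balaban1988Convergent, (2.12) p.256 (typing convention)] -/
theorem UminOfRecord_of_not {𝔹 : DetSet P} {W : MSField P G} (h : ¬ ∃ U₀, IsMinimizer av reg 𝔹 W U₀) :
    UminOfRecord av reg 𝔹 W = fun _ => 1 := by
  unfold UminOfRecord
  split_ifs with hsel
  · exact (Classical.choose_spec hsel).2.2 W h
  · rfl

/-- **`UminOfRecord` IS A FUNCTION OF THE (2.12) PREDICATE** (by construction in both branches). [cite: Balaban1988Convergent, (2.12) p.256 (bookkeeping)] -/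
theorem UminOfRecord_congr_of_isMinimizer_iff₀ {𝔹 : DetSet P} {W W' : MSField P G}
    (h : ∀ U₀, IsMinimizer av reg 𝔹 W U₀ ↔ IsMinimizer av reg 𝔹 W' U₀) :
    UminOfRecord av reg 𝔹 W = UminOfRecord av reg 𝔹 W' := by
  have hpred : IsMinimizer av reg 𝔹 W = IsMinimizer av reg 𝔹 W' := funext fun U₀ => propext (h U₀)
  unfold UminOfRecord
  rw [hpred]

/-- **THE MEASURABLE BRANCH**: if an admissible predicate-fed selector exists, the solution map of record IS MEASURABLE in the data `W`.
[cite: Balaban1988Convergent, (2.12) p.256 (typing convention)] -/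
theorem measurable_UminOfRecord_of_exists_selSpec {𝔹 : DetSet P} (h : ∃ F, SelSpec av reg 𝔹 F) :
    Measurable (UminOfRecord av reg 𝔹) := by
  have heq : UminOfRecord av reg 𝔹 = fun W => Classical.choose h (IsMinimizer av reg 𝔹 W) := by
    funext W
    unfold UminOfRecord
    rw [dif_pos h]
  rw [heq]
  exact (Classical.choose_spec h).1

/-- Lifting a `W`-fed selector `f` to a predicate-fed one: on a (2.12) predicate `p = IsMinimizer … W₁` return `f W₁` (any such `W₁`),
else the unit. [cite: Balaban1988Convergent, (2.12) p.256 (typing convention)] -/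
noncomputable def predLift (𝔹 : DetSet P) (f : MSField P G → GaugeField P 0 G) (p : GaugeField P 0 G → Prop) : GaugeField P 0 G :=
  open Classical in
  if h : ∃ W₁ : MSField P G, IsMinimizer av reg 𝔹 W₁ = p then f (Classical.choose h) else fun _ => 1

omit [MeasurableSpace G] in
/-- On the predicate of `W`, the lift of a DETERMINED selector returns `f W`. [cite: Balaban1988Convergent, (2.12) p.256 (bookkeeping)] -/
theorem predLift_apply_isMinimizer {𝔹 : DetSet P} {f : MSField P G → GaugeField P 0 G}
    (hdet : ∀ W W' : MSField P G, (∀ U₀, IsMinimizer av reg 𝔹 W U₀ ↔ IsMinimizer av reg 𝔹 W' U₀) → f W = f W')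
    (W : MSField P G) : predLift av reg 𝔹 f (IsMinimizer av reg 𝔹 W) = f W := by
  have h : ∃ W₁ : MSField P G, IsMinimizer av reg 𝔹 W₁ = IsMinimizer av reg 𝔹 W := ⟨W, rfl⟩
  unfold predLift
  rw [dif_pos h]
  exact hdet _ _ fun U₀ => by rw [Classical.choose_spec h]

/-- **A MEASURABLE, MINIMISING, UNIT-OFF-THE-SOLVABLE-SET, DETERMINED `W`-fed selector yields an admissible predicate-fed selector**
(the form in which the K′-side supplies it: `Record12MinimiserSelection.exists_measurable_isMinimizer_selector_determined`).
[cite: Balaban1988Convergent, (2.12) p.256 (typing convention)] -/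
theorem exists_selSpec_of_selector {𝔹 : DetSet P} (f : MSField P G → GaugeField P 0 G) (hf : Measurable f)
    (hmin : ∀ W : MSField P G, (∃ U₀, IsMinimizer av reg 𝔹 W U₀) → IsMinimizer av reg 𝔹 W (f W))
    (hjunk : ∀ W : MSField P G, ¬ (∃ U₀, IsMinimizer av reg 𝔹 W U₀) → f W = 1)
    (hdet : ∀ W W' : MSField P G, (∀ U₀, IsMinimizer av reg 𝔹 W U₀ ↔ IsMinimizer av reg 𝔹 W' U₀) → f W = f W') :
    ∃ F, SelSpec av reg 𝔹 F := by
  have key : (fun W : MSField P G => predLift av reg 𝔹 f (IsMinimizer av reg 𝔹 W)) = f :=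
    funext (predLift_apply_isMinimizer av reg hdet)
  refine ⟨predLift av reg 𝔹 f, ?_, ?_, ?_⟩
  · rw [key]; exact hf
  · intro W hW
    rw [predLift_apply_isMinimizer av reg hdet W]
    exact hmin W hW
  · intro W hW
    rw [predLift_apply_isMinimizer av reg hdet W]
    exact hjunk W hW

/-- Hence: such a `W`-fed selector makes the solution map of record MEASURABLE. [cite: Balaban1988Convergent, (2.12) p.256 (typing convention)] -/
theorem measurable_UminOfRecord_of_selector {𝔹 : DetSet P} (f : MSField P G → GaugeField P 0 G) (hf : Measurable f)
    (hmin : ∀ W : MSField P G, (∃ U₀, IsMinimizer av reg 𝔹 W U₀) → IsMinimizer av reg 𝔹 W (f W))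
    (hjunk : ∀ W : MSField P G, ¬ (∃ U₀, IsMinimizer av reg 𝔹 W U₀) → f W = 1)
    (hdet : ∀ W W' : MSField P G, (∀ U₀, IsMinimizer av reg 𝔹 W U₀ ↔ IsMinimizer av reg 𝔹 W' U₀) → f W = f W') :
    Measurable (UminOfRecord av reg 𝔹) :=
  measurable_UminOfRecord_of_exists_selSpec av reg (exists_selSpec_of_selector av reg f hf hmin hjunk hdet)

/-- **The (2.12) solution datum of record** as r12's `DetBackground`: regularity class `reg`, domain = the solvable set, `U` = the
solution map of record, and the minimising property PROVED on the domain. [cite: Balaban1988Convergent, (2.12) p.256] -/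
def bgOfRecord : DetBackground P G av where
  reg := reg
  dom := solvableDom av reg
  U := UminOfRecord av reg
  isMinimizer := fun _ _ h => isMinimizer_UminOfRecord av reg h

/-- Unfolding: the solution map of the datum of record. [cite: Balaban1988Convergent, (2.12) p.256 (bookkeeping)] -/
theorem bgOfRecord_U : (bgOfRecord av reg).U = UminOfRecord av reg := rfl

/-- Unfolding: the domain of the datum of record is the solvable set. [cite: Balaban1988Convergent, (2.12) p.256 (bookkeeping)] -/
theorem bgOfRecord_dom : (bgOfRecord av reg).dom = solvableDom av reg := rfl

/-- Unfolding: the regularity class of the datum of record. [cite: Balaban1988Convergent, (2.12) p.256 (bookkeeping)] -/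
theorem bgOfRecord_reg : (bgOfRecord av reg).reg = reg := rfl

end SolutionMap

/-! ## §3  (2.5): `R_k` of record, and the `LM₂R_k`-cube geometry of (2.17) on the torus `T_η = Site P 0` -/

open Classical in
/-- **`R_j` of record**, (2.5) p. 255, verbatim: *"R_j is the smallest number of the form L^r such, that R_j ≥ (log g_j⁻²)^r"* —
`L^s` for the least `s` with `(log g⁻²)^r ≤ L^s` when such an `s` exists (always, for `L ≥ 2`), and `1` otherwise (junk branch).
[cite: Balaban1988Convergent, (2.5) p.255] -/
def RkOfRecord (L r : ℕ) (g : ℝ) : ℕ :=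
  if h : ∃ s : ℕ, (Real.log (g ^ 2)⁻¹) ^ r ≤ ((L ^ s : ℕ) : ℝ) then L ^ Nat.find h else 1

/-- For `L ≥ 2` the exponent of (2.5) exists. [cite: Balaban1988Convergent, (2.5) p.255 (bookkeeping)] -/
theorem exists_pow_ge_of_two_le {L : ℕ} (hL : 2 ≤ L) (r : ℕ) (g : ℝ) :
    ∃ s : ℕ, (Real.log (g ^ 2)⁻¹) ^ r ≤ ((L ^ s : ℕ) : ℝ) := by
  obtain ⟨n, hn⟩ := pow_unbounded_of_one_lt ((Real.log (g ^ 2)⁻¹) ^ r) (by exact_mod_cast hL : (1 : ℝ) < L)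
  exact ⟨n, by exact_mod_cast hn.le⟩

/-- `R_j` of record IS r11's (2.5) predicate `B14.IsRj` whenever `L ≥ 2` (the standing range has `L > 11`).
[cite: Balaban1988Convergent, (2.5) p.255] -/
theorem isRj_RkOfRecord {L : ℕ} (hL : 2 ≤ L) (r : ℕ) (g : ℝ) : B14.IsRj L r g (RkOfRecord L r g) := by
  have h := exists_pow_ge_of_two_le hL r g
  refine ⟨Nat.find h, by simp [RkOfRecord, dif_pos h], ?_, fun s' hs' => Nat.find_min' h hs'⟩
  have := Nat.find_spec h
  simpa [RkOfRecord, dif_pos h] using this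

/-- The side, in sites of the fine lattice `T_η = T^{(0)}`, of a cube *"of the size LM₂R_k"* of (2.17) at step `k`: `LM₂R_k` unit
lengths = `L^{k+1}·M₂·R_k` fine sites (unit length = `L^k` fine spacings, `η = L^{−k}`; cf. (2.13)'s `L^nξM₁`-cubes =
`B14.Eq213MaximalDomains.side L M₁ n` fine sites). [cite: Balaban1988Convergent, (2.17) p.257] -/
def cubeSide (L M₂ Rk k : ℕ) : ℕ := L ^ (k + 1) * M₂ * Rk

section CubeGeometry

variable (P : Params)

/-- The index family of the `s`-cube partition of `T_η`: cube indices `a ∈ {0, …, q−1}^d`, `q = ⌈(2L^{m+K})∕s⌉`, the cube of index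
`a` being `{z : s a_i ≤ z_i ≤ s a_i + s − 1}` on the universal cover (`B14DomainGeom.cubeIdx`), pushed to the torus by
`B15Eq112TorusCover.cover` — print's *"partition of the lattice T_η into cubes of the size LM₂R_k … compatible with all other
partitions"* (a partition when `s ∣ 2L^{m+K}`; the definition is total either way; print's «compatible» — the `LM₂R_k`-,
`MR_k`-, `M₁`-cube partitions and the `k`-blocks mutually nested — is realised by these cubes only for NESTED sides, i.e. `M₁`,
`M₂` powers of `L` like `R_k = L^s`: a numeric side condition for node00-def's admissibility, dag-n11-a's located reading
[DAGN11A-G2-READING-1-CUBESIDE]; sizes in fine sites per `B14DomainGeom`'s convention of record). [cite: Balaban1988Convergent, (2.17) p.257] -/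
def cubeIndices (s : ℕ) : Finset (Pt P.d) :=
  Fintype.piFinset fun _ => (Finset.range ((P.sitesPerDir 0 + s - 1) / s)).image (Nat.cast : ℕ → ℤ)

/-- The `s`-cube of index `a` enlarged by `n` layers of `s`-cubes, on the torus: `n = 0` the cube `□`, `n = 1` its neighbourhood
`□^∼`, `n = 4` the domain `□^{∼4}` of (2.16) (`B14.Eq213MaximalDomains.cubeExt` with collar `n·s`, pushed forward by `cover`).
[cite: Balaban1988Convergent, (2.16)–(2.17) p.257] -/
def cubeEnl (s : ℕ) (a : Pt P.d) (n : ℕ) : Set (Site P 0) :=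
  cover P '' cubeExt s a ((n * s : ℕ) : ℤ)

variable {P}

/-- The plaquettes of `T_η` lying inside a site set (all four corners in it) — print's *"p ⊂ □^∼"* in (2.17).
[cite: Balaban1988Convergent, (2.17) p.257] -/
def plaqInside (S : Set (Site P 0)) : Set (Plaq P 0) :=
  {p | p.src ∈ S ∧ p.src.shift p.μ ∈ S ∧ p.src.shift p.ν ∈ S ∧ (p.src.shift p.μ).shift p.ν ∈ S}

/-- Membership in `plaqInside`. [cite: Balaban1988Convergent, (2.17) p.257 (bookkeeping)] -/
theorem mem_plaqInside_iff (S : Set (Site P 0)) (p : Plaq P 0) :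
    p ∈ plaqInside S ↔ p.src ∈ S ∧ p.src.shift p.μ ∈ S ∧ p.src.shift p.ν ∈ S ∧ (p.src.shift p.μ).shift p.ν ∈ S :=
  Iff.rfl

end CubeGeometry

/-! ## §4  `χ_k(T_η)` of record ([III] (2.17) over all cubes) -/

variable (F : T4Family) (N : ℕ) [NeZero N]

/-- The small-field thresholds of record along a coupling sequence `g`: `ε_k = g_k · A₀ (log g_k⁻²)^{p₀}` ((2.4) p. 255; =
`Setup.epsK` of the flow with couplings `g`, `epsOfRecord_eq_epsK`). [cite: Balaban1988Convergent, (2.4) p.255] -/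
def epsOfRecord (ν : Stage7Numerics) (g : ℕ → ℝ) (k : ℕ) : ℝ :=
  g k * p0Profile ν.A₀ ν.p₀ (g k)

/-- `epsOfRecord` is `Setup.epsK` read along the flow's couplings. [cite: Balaban1988Convergent, (2.4) p.255 (bookkeeping)] -/
theorem epsOfRecord_eq_epsK (ν : Stage7Numerics) (Fl : Flow) (k : ℕ) :
    epsOfRecord ν Fl.g k = epsK ν.A₀ ν.p₀ Fl k := rfl

/-- **`χ_k(T_η)` OF RECORD** — [III] (2.17) p. 257, verbatim: *"χ_k(Ω_k) = Π_{□⊂Ω_k} χ({sup_{p⊂□^∼}|U_{k,□}(V_k, ∂p) − 1| < ε_kη²}),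
where the cubes □ belong to the partition of the lattice T_η into cubes of the size LM₂R_k"*, at `Ω_k = T_η` (ALL cubes; the
`χ_k = χ_k(T_η)` of [B16] (0.1), `B16.RunData.χ`): r11's `B14.Eq216Concrete.chi217` WITH the (2.12) solution datum of record
`bgOfRecord` (§2), the cube family of §3 with side `L^{k+1}M₂R_k`, `R_k = RkOfRecord L r g_k`, plaquette sets `p ⊂ □^∼`, domains
`□^{∼4}`, threshold `ε_k` of `epsOfRecord`.  Its background is the LOCAL minimiser (2.16) `ukBox`, not the global `U_k`.  Indexed by the
torus exponent `K` and a coupling sequence `g` (node00-def reads it at `K = p.K`, `g = FlowStepRuns.genSeq βfun p.g₀`; node00-def-B's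
action slot reads it as `fun K g k => chiOfRecord F N ν g K k`). [cite: Balaban1988Convergent, (2.17) p.257] -/
def chiOfRecord (ν : Stage7Numerics) (g : ℕ → ℝ) (K k : ℕ) :
    GaugeField (F.P K) k (SU N) → ℝ :=
  chi217 (bgOfRecord (avOfRecord F N K) {U | PlaqSmall (ν.εreg * (F.P K).eta k ^ 2) U}) ν.M₁
    (cubeIndices (F.P K) (cubeSide (F.P K).L ν.M₂ (RkOfRecord (F.P K).L ν.r (g k)) k))
    (fun a => plaqInside (cubeEnl (F.P K) (cubeSide (F.P K).L ν.M₂ (RkOfRecord (F.P K).L ν.r (g k)) k) a 1))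
    (fun a => cubeEnl (F.P K) (cubeSide (F.P K).L ν.M₂ (RkOfRecord (F.P K).L ν.r (g k)) k) a 4)
    (epsOfRecord ν g k) k

/-- Unfolding of `χ_k(T_η)` of record as r11's (2.17) `chi217`. [cite: Balaban1988Convergent, (2.17) p.257 (bookkeeping)] -/
theorem chiOfRecord_eq_chi217 (ν : Stage7Numerics) (g : ℕ → ℝ) (K k : ℕ) :
    chiOfRecord F N ν g K k =
      chi217 (bgOfRecord (avOfRecord F N K) {U | PlaqSmall (ν.εreg * (F.P K).eta k ^ 2) U}) ν.M₁
        (cubeIndices (F.P K) (cubeSide (F.P K).L ν.M₂ (RkOfRecord (F.P K).L ν.r (g k)) k))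
        (fun a => plaqInside (cubeEnl (F.P K) (cubeSide (F.P K).L ν.M₂ (RkOfRecord (F.P K).L ν.r (g k)) k) a 1))
        (fun a => cubeEnl (F.P K) (cubeSide (F.P K).L ν.M₂ (RkOfRecord (F.P K).L ν.r (g k)) k) a 4)
        (epsOfRecord ν g k) k := rfl

/-- `0 ≤ χ_k(T_η)` (a product of 0∕1 characteristic functions) — the sign fact [B16] (0.1)'s consumers ask for
(`B16B10Shape.bounds5_of_uv01`'s `hχ`). [cite: Balaban1988Convergent, (2.17) p.257 (bookkeeping)] -/
theorem chiOfRecord_nonneg (ν : Stage7Numerics) (g : ℕ → ℝ) (K k : ℕ)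
    (V : GaugeField (F.P K) k (SU N)) : 0 ≤ chiOfRecord F N ν g K k V := by
  rw [chiOfRecord_eq_chi217, chi217_apply]
  exact Finset.prod_nonneg fun _ _ => by unfold chiSmall; split_ifs <;> norm_num

/-- `χ_k(T_η) ≤ 1`. [cite: Balaban1988Convergent, (2.17) p.257 (bookkeeping)] -/
theorem chiOfRecord_le_one (ν : Stage7Numerics) (g : ℕ → ℝ) (K k : ℕ)
    (V : GaugeField (F.P K) k (SU N)) : chiOfRecord F N ν g K k V ≤ 1 := by
  rw [chiOfRecord_eq_chi217, chi217_apply]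
  exact Finset.prod_le_one (fun _ _ => by unfold chiSmall; split_ifs <;> norm_num)
    fun _ _ => by unfold chiSmall; split_ifs <;> norm_num

/-- `χ_k(T_η)(V_k) = 1` exactly when, for every cube `□` of the partition, all plaquettes `p ⊂ □^∼` are small for the local
background `U_{k,□}(V_k)`: `|U_{k,□}(V_k)(∂p) − 1| < ε_kη²` (r11's `chi217_eq_one_iff`). [cite: Balaban1988Convergent, (2.17) p.257] -/
theorem chiOfRecord_eq_one_iff (ν : Stage7Numerics) (g : ℕ → ℝ) (K k : ℕ)
    (V : GaugeField (F.P K) k (SU N)) :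
    chiOfRecord F N ν g K k V = 1 ↔
      ∀ a ∈ cubeIndices (F.P K) (cubeSide (F.P K).L ν.M₂ (RkOfRecord (F.P K).L ν.r (g k)) k),
        PlaqSmallOn (plaqInside (cubeEnl (F.P K) (cubeSide (F.P K).L ν.M₂ (RkOfRecord (F.P K).L ν.r (g k)) k) a 1))
          (epsOfRecord ν g k * (F.P K).eta k ^ 2)
          (ukBox (bgOfRecord (avOfRecord F N K) {U | PlaqSmall (ν.εreg * (F.P K).eta k ^ 2) U}) ν.M₁
            (cubeEnl (F.P K) (cubeSide (F.P K).L ν.M₂ (RkOfRecord (F.P K).L ν.r (g k)) k) a 4) k V) := by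
  rw [chiOfRecord_eq_chi217]
  exact chi217_eq_one_iff _ _ _ _ _ _ _ _

/-- JUNK CORNER (documented for node00-def's numeric admissibility and n13-b's probe): with `M₂ = 0` the cube side is `0`, the
cube family is empty and `χ_k(T_η) ≡ 1` (empty product) — so `Stage7Params` must require `1 ≤ M₂` (print: `M₂` a large power
of `L`). [cite: Balaban1988Convergent, (2.17) p.257 (typing convention)] -/
theorem chiOfRecord_of_M₂_eq_zero (ν : Stage7Numerics) (hM : ν.M₂ = 0) (g : ℕ → ℝ) (K k : ℕ)
    (V : GaugeField (F.P K) k (SU N)) : chiOfRecord F N ν g K k V = 1 := by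
  rw [chiOfRecord_eq_chi217, chi217_apply]
  have hs : cubeSide (F.P K).L ν.M₂ (RkOfRecord (F.P K).L ν.r (g k)) k = 0 := by simp [cubeSide, hM]
  haveI : Nonempty (Fin (F.P K).d) := ⟨⟨0, (F.P K).hd⟩⟩
  rw [hs]
  simp [cubeIndices]

/-! ## §5  The small-field domain of [I] p. 259, SECOND printed form (the first form, over the global background `U_k(V)` of
(0.21) [I], reads node00-def-B's `Uk` and lands in `Node00/SmallFieldDomOfRecord.lean` after `Node00/BackgroundActionOfRecord.lean`) -/

/-- **The small-field domain of record, second printed form** — [I] p. 259, verbatim: *"Another possible definition, technically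
less convenient, is given by the condition |∂V − 1| < ε₀ on T₁^{(k)}."* (no residual at all). [cite: Balaban1987RG1, p.259] -/
def domAltOfRecord (ν : Stage7Numerics) (K k : ℕ) : Set (GaugeField (F.P K) k (SU N)) :=
  {V | PlaqSmall ν.ε₀ V}

/-- Membership in the second-form domain. [cite: Balaban1987RG1, p.259 (bookkeeping)] -/
theorem mem_domAltOfRecord_iff (ν : Stage7Numerics) (K k : ℕ) (V : GaugeField (F.P K) k (SU N)) :
    V ∈ domAltOfRecord F N ν K k ↔ PlaqSmall ν.ε₀ V := Iff.rfl

/-! ## §6  `E` of record: the sum over all scales of the one-step vacuum-energy expressions -/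

/-- `d(𝔤) = dim su(N) = N² − 1` (the `d(𝔤)` of (1.15) [III] ∕ (2.8) [I]). [cite: Balaban1988Convergent, (1.15) p.249] -/
def dimSU : ℕ := N ^ 2 - 1

/-- `|T₁^{(j)}|` = the number of sites of `T^{(j)}` (= `(2L^{m+K−j})^d` in the standing range). [cite: Balaban1987RG1, (0.1) p.251] -/
def sitesCard (P : Params) (j : ℕ) : ℝ := Fintype.card (Site P j)

/-- READER'S COUNT (pv24, labelled as such in `B16B10Shape.CountertermData.TstarCount`): the bond number `|T^{(j)*}| = 4(|T₁^{(j)}| −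
|T₁^{(j+1)}|)` of (1.15) for `Ω = ` the whole 4-dimensional lattice. [cite: Balaban1988Convergent, (1.15) p.249] -/
def tstarCount (P : Params) (j : ℕ) : ℝ := 4 * sitesCard P j - 4 * sitesCard P (j + 1)

/-- **The scale-`j` one-step vacuum-energy expression** subtracted from `E` ([III] p. 254 l. 14–16: *"the constants in the first
exponential in (1.15), and the constant E^{(1)}(Λ₁, g₀, 1)"*, generic scale per [B16] p. 356 (1.10)): `d(𝔤) log g_j |T^{(j)*}| +
log σ₀ |T^{(j)*}| − log z_j (L⁴ − 1)|T₁^{(j+1)}| + E^{(j+1)}(T^{(j+1)}, g_j, 1)`, with the fluctuation constant `Efl j` and `logz j`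
as INPUTS (the small-field step's, ₈) — literally the right-hand side of `CountertermData.OneStep115`. [cite: Balaban1988Convergent, (1.15) p.249; p.254] -/
def eStepOfRecord (ν : Stage7Numerics) (Efl logz g : ℕ → ℝ) (P : Params) (j : ℕ) : ℝ :=
  Real.log (g j) * (dimSU N : ℕ) * tstarCount P j + ν.logσ₀ * tstarCount P j
    - logz j * (((P.L : ℝ) ^ 4 - 1) * sitesCard P (j + 1)) + Efl j

/-- **`E` OF RECORD** — [III] Thm 1 p. 262: *"ρ₀ = exp[−(1∕g₀²)A − E]"*; p. 262 l. 17–21, verbatim: *"This initial constant is defined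
in fact as a sum of all such expressions [one-step vacuum energy expressions generated in small field regions] for all the
lattices T^{(k)} as the small field regions."* — `E = Σ_{j<K} e_j` over the run's `K` steps, with the per-run inputs `Efl p`,
`logz p` (₈'s) and the run's couplings `g p`. NOT a closed form before ₈; NOT `log ∫ρ₀`. [cite: Balaban1988Convergent, Thm 1 p.262; (1.15) p.249; p.254] -/
def EOfRecord (ν : Stage7Numerics) (Efl logz g : B12.RunParams → ℕ → ℝ) (p : B12.RunParams) : ℝ :=
  ∑ j ∈ Finset.range p.K, eStepOfRecord N ν (Efl p) (logz p) (g p) (F.P p.K) j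

/-- The record's instance of pv24's per-scale carrier `B16B10Shape.CountertermData` for the run `p`. [cite: Balaban1988Convergent, (1.15) p.249; Thm 1 p.262] -/
def countertermDataOfRecord (ν : Stage7Numerics) (Efl logz g : B12.RunParams → ℕ → ℝ) (p : B12.RunParams) :
    CountertermData where
  K := p.K
  N := sitesCard (F.P p.K)
  g := g p
  dg := dimSU N
  L := (F.P p.K).L
  logσ₀ := ν.logσ₀
  Tstar := tstarCount (F.P p.K)
  logz := logz p
  Efl := Efl p
  e := eStepOfRecord N ν (Efl p) (logz p) (g p) (F.P p.K)
  E := EOfRecord F N ν Efl logz g p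

omit [NeZero N] in
/-- pv24's hypothesis `OneStep115` ((1.15) p. 249 + p. 254, generic scale) HOLDS for the record's carrier, by `rfl`.
[cite: Balaban1988Convergent, (1.15) p.249; p.254] -/
theorem oneStep115_of_record (ν : Stage7Numerics) (Efl logz g : B12.RunParams → ℕ → ℝ) (p : B12.RunParams) :
    (countertermDataOfRecord F N ν Efl logz g p).OneStep115 := fun _ _ => rfl

omit [NeZero N] in
/-- pv24's hypothesis `ESum` (p. 262 l. 17–21) HOLDS for the record's carrier, by `rfl`. [cite: Balaban1988Convergent, Thm 1 p.262] -/
theorem eSum_of_record (ν : Stage7Numerics) (Efl logz g : B12.RunParams → ℕ → ℝ) (p : B12.RunParams) :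
    (countertermDataOfRecord F N ν Efl logz g p).ESum := rfl

omit [NeZero N] in
/-- pv24's reader's count `TstarCount` HOLDS for the record's carrier, by `rfl`. [cite: Balaban1988Convergent, (1.15) p.249 (bookkeeping)] -/
theorem tstarCount_of_record (ν : Stage7Numerics) (Efl logz g : B12.RunParams → ℕ → ℝ) (p : B12.RunParams) :
    (countertermDataOfRecord F N ν Efl logz g p).TstarCount := fun _ _ => rfl

end Literature.MathematicalPhysics.QuantumFieldTheory.Balaban1983to89.Node00

end
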